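import Literature.Geometry.Lorentzian.KerrStarWaveOperator
import Mathlib.MeasureTheory.Function.Jacobian
import Mathlib.Analysis.SpecialFunctions.Trigonometric.Angle
import HarnessLib

/-!
# The Jacobian of the Kerr-star chart and the change of variables `dVol = ρ² sin θ dt* dr dθ dφ*`

The Kerr-star chart map `κ_a(t*, r, θ, φ*) = (t*, Y_a(r, θ, φ*))` (`Kerr.starChart`; Kerr's ingoing
spheroidal coordinates `x + iy = (r + ia)e^{iφ} sin θ`, `z = r cos θ` on the leaves, Visser
arXiv:0706.0622, §4) has Jacobian determinant `det Dκ_a = (r² + a² cos²θ) sin θ = ρ² sin θ`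
(`Kerr.det_fderiv_starChart`) — the density of the spacetime volume form in Kerr-star coordinates,
the Kerr–Schild chart being unimodular (`det g = -1`, DRSR arXiv:1402.7034, §2.1). We prove the
injectivity of `κ_a` on `{r > 0, 0 < θ < π, -π < φ ≤ π}` (`Kerr.injOn_starChart`), identify the
image with the region `{r(x) ∈ R}` off the axis (`Kerr.starChart_image`), show the axis is
Lebesgue-null, and conclude the **change-of-variables formula**
(`Kerr.lintegral_radius_mem_eq`): for measurable `R ⊆ (0, ∞)` and every `g ≥ 0`,
`∫⁻_{x : r(x) ∈ R} g dx = ∫⁻_{t* ∈ ℝ, r ∈ R, θ ∈ (0,π), φ ∈ (-π,π]} ρ² sin θ · g(κ_a(t*, r, θ, φ))`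
(Mathlib's `lintegral_image_eq_lintegral_abs_det_fderiv_mul`). This is the bridge between the
spacetime integrals of the physical-space estimates and the `(t*, r) × S²` slicing used by
Carter's separation (DRSR §5.3, "Plancherel").

## References

* M. Visser, *The Kerr spacetime: a brief introduction*, arXiv:0706.0622, §4. [arXiv07060622]
* M. Dafermos, I. Rodnianski, Y. Shlapentokh-Rothman, arXiv:1402.7034, §2.1, §5.3.
  [DafermosRodnianskiShlapentokhrothman2014]
-/

noncomputable section

open Real Set Filter MeasureTheory Function
open scoped Topology ENNReal

namespace Literature.Geometry.Lorentzian

namespace Kerr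

/-! ### The Jacobian determinant -/

/-- **`det Dκ_a(q) = (r² + a² cos²θ) sin θ`** (`r = q 1`, `θ = q 2`). [cite: arXiv07060622, §4] -/
theorem det_fderiv_starChart (a : ℝ) (q : E4) :
    (fderiv ℝ (starChart a) q).det = ((q 1) ^ 2 + a ^ 2 * cos (q 2) ^ 2) * sin (q 2) := by
  set b := (EuclideanSpace.basisFun (Fin 4) ℝ).toBasis with hb
  have hdet := LinearMap.det_toMatrix b ((fderiv ℝ (starChart a) q : E4 →L[ℝ] E4) : E4 →ₗ[ℝ] E4)
  rw [show (fderiv ℝ (starChart a) q).det =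
    LinearMap.det ((fderiv ℝ (starChart a) q : E4 →L[ℝ] E4) : E4 →ₗ[ℝ] E4) from rfl, ← hdet]
  have hM : LinearMap.toMatrix b b ((fderiv ℝ (starChart a) q : E4 →L[ℝ] E4) : E4 →ₗ[ℝ] E4) =
      Matrix.of fun i j ↦ (starFrame a q j) i := by
    ext i j
    rw [LinearMap.toMatrix_apply, Matrix.of_apply, ContinuousLinearMap.coe_coe, hb,
      OrthonormalBasis.coe_toBasis_repr_apply, EuclideanSpace.basisFun_repr,
      OrthonormalBasis.coe_toBasis, EuclideanSpace.basisFun_apply,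
      show EuclideanSpace.single j (1 : ℝ) = E4.basisVector j from rfl,
      fderiv_starChart_basisVector]
  have h1 : ∀ v : E3, (E4.ofTimeSpace 0 v) 1 = v 0 := fun v ↦ E4.ofTimeSpace_apply_succ 0 v 0
  have h2 : ∀ v : E3, (E4.ofTimeSpace 0 v) 2 = v 1 := fun v ↦ E4.ofTimeSpace_apply_succ 0 v 1
  have h3 : ∀ v : E3, (E4.ofTimeSpace 0 v) 3 = v 2 := fun v ↦ E4.ofTimeSpace_apply_succ 0 v 2
  rw [hM, Matrix.det_succ_row_zero, Fin.sum_univ_four]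
  simp [Matrix.det_fin_three, Matrix.submatrix, Fin.succAbove, starFrame,
    E4.ofTimeSpace_apply_zero, E4.basisVector, h1, h2, h3]
  have hθ := sin_sq_add_cos_sq (q 2)
  have hφ := cos_sq_add_sin_sq (q 3)
  linear_combination (sin (q 2) * q 1 ^ 2 * cos (q 2) ^ 2 + sin (q 2) * a ^ 2 * cos (q 2) ^ 2 +
    sin (q 2) ^ 3 * q 1 ^ 2) * hφ + (sin (q 2) * q 1 ^ 2) * hθ

/-- On `{r ≠ 0, 0 < θ < π}` the Jacobian determinant is positive. [folklore] -/
theorem det_fderiv_starChart_pos (a : ℝ) {q : E4} (hr : q 1 ≠ 0) (hθ : q 2 ∈ Ioo 0 π) :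
    0 < (fderiv ℝ (starChart a) q).det := by
  rw [det_fderiv_starChart]
  exact mul_pos (by positivity) (sin_pos_of_pos_of_lt_pi hθ.1 hθ.2)

/-! ### The coordinate domain, injectivity and the image -/

/-- The coordinate domain `{t* ∈ ℝ, r ∈ R, θ ∈ (0, π), φ ∈ (-π, π]}`. [cite: arXiv07060622, §4] -/
def starDomain (R : Set ℝ) : Set E4 :=
  {q | q 1 ∈ R ∧ q 2 ∈ Ioo 0 π ∧ q 3 ∈ Ioc (-π) π}

/-- Membership. [folklore] -/
theorem mem_starDomain {R : Set ℝ} {q : E4} :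
    q ∈ starDomain R ↔ q 1 ∈ R ∧ q 2 ∈ Ioo 0 π ∧ q 3 ∈ Ioc (-π) π := Iff.rfl

/-- The coordinate domain is measurable for measurable `R`. [folklore] -/
theorem measurableSet_starDomain {R : Set ℝ} (hR : MeasurableSet R) :
    MeasurableSet (starDomain R) := by
  have hm : ∀ i : Fin 4, Measurable fun q : E4 ↦ q i := fun i ↦
    (EuclideanSpace.proj (𝕜 := ℝ) i).continuous.measurable
  exact ((hm 1) hR).inter (((hm 2) measurableSet_Ioo).inter ((hm 3) measurableSet_Ioc))

/-- Two angles in `(-π, π]` with the same cosine and sine are equal. [folklore] -/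
theorem eq_of_cos_eq_of_sin_eq {φ ψ : ℝ} (hφ : φ ∈ Ioc (-π) π) (hψ : ψ ∈ Ioc (-π) π)
    (hc : cos φ = cos ψ) (hs : sin φ = sin ψ) : φ = ψ := by
  have h : (φ : Real.Angle) = ψ := Real.Angle.cos_sin_inj hc hs
  haveI : Fact (0 < 2 * π) := ⟨two_pi_pos⟩
  have hφ' : φ ∈ Ioc (-π) (-π + 2 * π) := by convert hφ using 2; ring
  have hψ' : ψ ∈ Ioc (-π) (-π + 2 * π) := by convert hψ using 2; ring
  exact (AddCircle.coe_eq_coe_iff_of_mem_Ioc hφ' hψ').1 h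

/-- **Injectivity of `κ_a` on `{r > 0, 0 < θ < π, -π < φ ≤ π}`.** [cite: arXiv07060622, §4] -/
theorem injOn_starChart (a : ℝ) {R : Set ℝ} (hR0 : R ⊆ Ioi 0) :
    InjOn (starChart a) (starDomain R) := by
  intro q hq q' hq' heq
  have hr : 0 < q 1 := hR0 hq.1
  have hr' : 0 < q' 1 := hR0 hq'.1
  -- `t*`
  have h0 : q 0 = q' 0 := by rw [← starChart_apply_zero a q, heq, starChart_apply_zero]
  -- `r`
  have h1 : q 1 = q' 1 := by rw [← radius_starChart a hr, heq, radius_starChart a hr']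
  -- components
  have hc := fun i ↦ congrFun (congrArg (fun x : E4 ↦ (x : Fin 4 → ℝ)) heq) i
  have hx := hc 1
  have hy := hc 2
  have hz := hc 3
  simp only [starChart_eq_toLp] at hx hy hz
  change (q 1 * cos (q 3) - a * sin (q 3)) * sin (q 2) = (q' 1 * cos (q' 3) - a * sin (q' 3)) *
    sin (q' 2) at hx
  change (q 1 * sin (q 3) + a * cos (q 3)) * sin (q 2) = (q' 1 * sin (q' 3) + a * cos (q' 3)) *
    sin (q' 2) at hy
  change q 1 * cos (q 2) = q' 1 * cos (q' 2) at hz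
  -- `θ`
  have h2 : q 2 = q' 2 := by
    have hcos : cos (q 2) = cos (q' 2) := by
      rw [← h1] at hz; exact mul_left_cancel₀ hr.ne' hz
    exact injOn_cos ⟨hq.2.1.1.le, hq.2.1.2.le⟩ ⟨hq'.2.1.1.le, hq'.2.1.2.le⟩ hcos
  -- `φ`
  have hs : sin (q 2) ≠ 0 := (sin_pos_of_pos_of_lt_pi hq.2.1.1 hq.2.1.2).ne'
  rw [← h1, ← h2] at hx hy
  have hx' := mul_right_cancel₀ hs hx
  have hy' := mul_right_cancel₀ hs hy
  have hra : 0 < q 1 ^ 2 + a ^ 2 := by positivity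
  have hcos : cos (q 3) = cos (q' 3) := by
    have : (q 1 ^ 2 + a ^ 2) * (cos (q 3) - cos (q' 3)) = 0 := by
      linear_combination (q 1) * hx' + a * hy'
    have := (mul_eq_zero.1 this).resolve_left hra.ne'
    linarith
  have hsin : sin (q 3) = sin (q' 3) := by
    have : (q 1 ^ 2 + a ^ 2) * (sin (q 3) - sin (q' 3)) = 0 := by
      linear_combination (q 1) * hy' - a * hx'
    have := (mul_eq_zero.1 this).resolve_left hra.ne'
    linarith
  have h3 : q 3 = q' 3 := eq_of_cos_eq_of_sin_eq hq.2.2 hq'.2.2 hcos hsin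
  ext i
  fin_cases i
  · exact h0
  · exact h1
  · exact h2
  · exact h3

/-- The Kerr–Schild radius of `x` is that of its leaf point `(0, x⃗)`. [folklore] -/
theorem radius_eq_radius_spatial (a : ℝ) (x : E4) :
    radius a x = radius a (E4.ofTimeSpace 0 (E4.spatial x)) := by
  conv_lhs => rw [← E4.ofTimeSpace_time_spatial x]
  rw [radius_ofTimeSpace, radius_ofTimeSpace]

/-- **The image of the coordinate domain** is the region `{r(x) ∈ R}` off the axis `{x = y = 0}`.
[cite: arXiv07060622, §4] -/
theorem starChart_image (a : ℝ) {R : Set ℝ} (hR0 : R ⊆ Ioi 0) :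
    starChart a '' starDomain R = {x | radius a x ∈ R ∧ (x 1 ≠ 0 ∨ x 2 ≠ 0)} := by
  ext x
  constructor
  · rintro ⟨q, hq, rfl⟩
    have hr : 0 < q 1 := hR0 hq.1
    refine ⟨show radius a (starChart a q) ∈ R by rw [radius_starChart a hr]; exact hq.1, ?_⟩
    have hs : sin (q 2) ≠ 0 := (sin_pos_of_pos_of_lt_pi hq.2.1.1 hq.2.1.2).ne'
    by_contra h
    simp only [not_or, not_not] at h
    obtain ⟨h1, h2⟩ := h
    simp only [starChart_eq_toLp] at h1 h2
    change (q 1 * cos (q 3) - a * sin (q 3)) * sin (q 2) = 0 at h1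
    change (q 1 * sin (q 3) + a * cos (q 3)) * sin (q 2) = 0 at h2
    have h1' := (mul_eq_zero.1 h1).resolve_right hs
    have h2' := (mul_eq_zero.1 h2).resolve_right hs
    have hsq : (q 1) ^ 2 + a ^ 2 = 0 := by
      have hφ := sin_sq_add_cos_sq (q 3)
      nlinarith [sq_nonneg (q 1 * cos (q 3) - a * sin (q 3)),
        sq_nonneg (q 1 * sin (q 3) + a * cos (q 3))]
    nlinarith [sq_nonneg a]
  · rintro ⟨hxR, hoff⟩
    set y : E3 := E4.spatial x with hy
    have hr0 : 0 < radius a (E4.ofTimeSpace 0 y) := by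
      rw [hy, ← radius_eq_radius_spatial]; exact hR0 hxR
    have hy01 : y 0 ≠ 0 ∨ y 1 ≠ 0 := by
      rw [hy, E4.spatial_apply, E4.spatial_apply]
      exact hoff
    obtain ⟨θ, hθ, φ, hφ⟩ := exists_kerrStar_eq hr0 hy01
    -- normalise `φ` into `(-π, π]`
    set ψ : ℝ := toIocMod two_pi_pos (-π) φ with hψ
    have hψmem : ψ ∈ Ioc (-π) π := by
      have h := toIocMod_mem_Ioc two_pi_pos (-π) φ
      rw [show -π + 2 * π = π by ring] at h
      exact h
    have hper : kerrStar a (radius a (E4.ofTimeSpace 0 y)) θ ψ =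
        kerrStar a (radius a (E4.ofTimeSpace 0 y)) θ φ := by
      obtain ⟨k, hk⟩ : ∃ k : ℤ, ψ = φ - k * (2 * π) := by
        refine ⟨toIocDiv two_pi_pos (-π) φ, ?_⟩
        rw [hψ, toIocMod, zsmul_eq_mul]
      have hc : cos ψ = cos φ := by rw [hk, cos_sub_int_mul_two_pi]
      have hs : sin ψ = sin φ := by rw [hk, sin_sub_int_mul_two_pi]
      ext i
      fin_cases i
      · show kerrStar a _ θ ψ 0 = kerrStar a _ θ φ 0
        rw [kerrStar_apply_zero, kerrStar_apply_zero, hc, hs]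
      · show kerrStar a _ θ ψ 1 = kerrStar a _ θ φ 1
        rw [kerrStar_apply_one, kerrStar_apply_one, hc, hs]
      · show kerrStar a _ θ ψ 2 = kerrStar a _ θ φ 2
        rw [kerrStar_apply_two, kerrStar_apply_two]
    refine ⟨WithLp.toLp 2 ![x 0, radius a (E4.ofTimeSpace 0 y), θ, ψ], ⟨?_, hθ, hψmem⟩, ?_⟩
    · show radius a (E4.ofTimeSpace 0 y) ∈ R
      rwa [hy, ← radius_eq_radius_spatial]
    · show starChart a _ = x
      rw [starChart]
      change E4.ofTimeSpace (x 0) (kerrStar a (radius a (E4.ofTimeSpace 0 y)) θ ψ) = x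
      rw [hper, hφ, hy]
      exact E4.ofTimeSpace_time_spatial x

/-! ### The axis is null -/

/-- The axis `{x = y = 0}` as a submodule of `E4`. [folklore] -/
def axisSubmodule : Submodule ℝ E4 where
  carrier := {x | x 1 = 0 ∧ x 2 = 0}
  add_mem' := by
    intro u v hu hv
    simp only [mem_setOf_eq, PiLp.add_apply] at hu hv ⊢
    rw [hu.1, hu.2, hv.1, hv.2]; simp
  zero_mem' := by simp
  smul_mem' := by
    intro c u hu
    simp only [mem_setOf_eq, PiLp.smul_apply, smul_eq_mul] at hu ⊢
    rw [hu.1, hu.2]; simp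

/-- The axis is a proper subspace. [folklore] -/
theorem axisSubmodule_ne_top : axisSubmodule ≠ ⊤ := by
  intro h
  have hmem : E4.basisVector 1 ∈ axisSubmodule := by rw [h]; exact Submodule.mem_top
  have h1 : (E4.basisVector 1 : E4) 1 = 0 := hmem.1
  simp [E4.basisVector] at h1

/-- **The axis is Lebesgue-null.** [folklore] -/
theorem volume_axis : volume {x : E4 | x 1 = 0 ∧ x 2 = 0} = 0 :=
  Measure.addHaar_submodule volume axisSubmodule axisSubmodule_ne_top

/-- The region `{r(x) ∈ R}` and the image of the coordinate domain agree a.e. [folklore] -/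
theorem starChart_image_ae_eq (a : ℝ) {R : Set ℝ} (hR0 : R ⊆ Ioi 0) :
    starChart a '' starDomain R =ᵐ[volume] {x : E4 | radius a x ∈ R} := by
  rw [starChart_image a hR0]
  refine (ae_eq_set).2 ⟨?_, ?_⟩
  · rw [show {x : E4 | radius a x ∈ R ∧ (x 1 ≠ 0 ∨ x 2 ≠ 0)} \ {x | radius a x ∈ R} = ∅ from by
      ext x
      simp only [Set.mem_sdiff, mem_setOf_eq, mem_empty_iff_false, iff_false, not_and, not_not]
      exact fun h ↦ h.1]
    exact measure_empty
  · refine measure_mono_null (fun x hx ↦ ?_) volume_axis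
    simp only [Set.mem_sdiff, mem_setOf_eq, not_and, not_or, not_not] at hx
    exact hx.2 hx.1

/-! ### The change of variables -/

/-- **`dVol = ρ² sin θ dt* dr dθ dφ*` on `{r(x) ∈ R}`**: for measurable `R ⊆ (0, ∞)` and every
`g : E4 → ℝ≥0∞`,
`∫⁻_{x : r(x) ∈ R} g = ∫⁻_{q ∈ starDomain R} (r² + a² cos²θ) sin θ · g(κ_a q)`.
[cite: DafermosRodnianskiShlapentokhrothman2014, §2.1, §5.3] -/
theorem lintegral_radius_mem_eq (a : ℝ) {R : Set ℝ} (hR : MeasurableSet R) (hR0 : R ⊆ Ioi 0)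
    (g : E4 → ℝ≥0∞) :
    ∫⁻ x in {x : E4 | radius a x ∈ R}, g x =
      ∫⁻ q in starDomain R,
        ENNReal.ofReal (((q 1) ^ 2 + a ^ 2 * cos (q 2) ^ 2) * sin (q 2)) * g (starChart a q) := by
  rw [← setLIntegral_congr (starChart_image_ae_eq a hR0)]
  have hd : ∀ q ∈ starDomain R, HasFDerivWithinAt (starChart a) (fderiv ℝ (starChart a) q)
      (starDomain R) q := fun q _ ↦
    (((contDiff_starChart a).differentiable one_ne_zero) q).hasFDerivAt.hasFDerivWithinAt
  rw [lintegral_image_eq_lintegral_abs_det_fderiv_mul volume (measurableSet_starDomain hR) hd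
    (injOn_starChart a hR0)]
  refine setLIntegral_congr_fun (measurableSet_starDomain hR) fun q hq ↦ ?_
  rw [abs_of_pos (det_fderiv_starChart_pos a (hR0 hq.1).ne' hq.2.1), det_fderiv_starChart]

end Kerr

end Literature.Geometry.Lorentzian
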